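import Literature.Barriers.ABC.BakerMethodBoundsBakerWustholzProofs
import HarnessLib

/-!
# Pasten's Theorem 1.4 (1): which archimedean input suffices (proofs)

Third proofs companion of `BakerMethodBounds.lean` for the named fact
`Literature.Barriers.ABC.pasten2024_thm_1_4_1` (H. Pasten, *The largest prime factor of
`n² + 1` and improvements on subexponential `ABC`*, Invent. Math. 236 (2024), 373–385,
Theorem 1.4 (1) [cite: Pasten2024, Theorem 1.4 (1)]: an absolute `κ > 0` with
`log c ≤ η⁻¹ exp(κ √((log R) log₂ R))` whenever `a ≤ c^{1−η}`, `R = rad(abc) ≥ R₀`).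
Theorems only; no definition, no named fact.

The printed proof (§4) combines Theorem 2.5 (Shimura curves,
`Literature.NumberTheory.DiophantineGeometry.pasten2024_thm_2_5`) with ONE archimedean lower
bound for linear forms in `m` logarithms of rational numbers, applied with
`m − 1 = #I ≤ 4 √(log R / log₂ R)` generators. The tree proves this deduction from three
packagings of the archimedean input: Evertse–Győry's Theorem 4.2.1 over `ℚ`
(`pasten2024_thm_1_4_1_of_facts`, `…SubexpProofs.pasten2024_thm_1_4_1_of`; that fact also
contains Yu's `p`-adic bounds), and Baker–Wüstholz 1993 over `ℚ` with its printed constant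
`C(n, 1) = 18 (n+1)! n^{n+1} 32^{n+2} log(2n)` (`pasten2024_thm_1_4_1_of_bakerWustholz`,
`…ArchimedeanProofs.pasten2024_thm_1_4_1_of_bakerWustholz_rat`). This file isolates WHAT the
argument of §4 needs from the archimedean theory and proves the deduction from that alone:

* `pasten2024_thm_1_4_1_of_archProductBound` — `pasten2024_thm_1_4_1` follows from
  `pasten2024_thm_2_5` together with ANY lower bound of the shape
  `log |log x| > −C(n) · (∏ᵢ max(h(αᵢ), 1))^q · log(e B)` for positive rationals
  `α₁, …, αₙ ≠ 1`, integers `eᵢ`, `x = ∏ αᵢ^{eᵢ} ≠ 1`, `B = max |eᵢ|`, with a fixed exponent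
  `q ∈ ℕ` and ANY constant of growth `log C(n) ≤ A · n · log(n + 1)` (`n ≥ 1`); the resulting
  exponent is `κ = 15 max(A, 0) + 6q + 9`.
* `archProductBound_of_bakerWustholz`, `log_bwConstant_one_le_growth` — Baker–Wüstholz 1993
  over `ℚ` (`baker_wustholz ℚ`, [cite: BakerWustholz2007, Thm 7.1]) is such a bound with `q = 1`,
  `A = 42`; so `pasten2024_thm_1_4_1_of_bakerWustholz` is recovered (as an `example`).
* `archProductBound_of_archBound` — so is any bound of the shape of Evertse–Győry's
  Theorem 3.2.4 over `ℚ` [cite: EvertseGyory2015, Thm 3.2.4 (p. 61)] (Matveev's shape: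
  `Aₖ ≥ max{h(aₖ), |log aₖ|, 0.16}`, `B ≥ max{1, |bₖ| Aₖ / A_{k₀}}`, conclusion
  `log |Σ bₖ log aₖ| > −C(n) A₁⋯Aₙ log(eB)`, `n ≥ 2`) with ANY constant `C(n)` — verbatim the
  archimedean binder `hM` of
  `Dioph.thm328_rat_infinite_of_archBound` / `Dioph.evertseGyory_thm_4_2_1_rat_of_archBound_padicBound`
  (`MultiplicativeGroupApproximationGenericInputsProofs.lean`), WITHOUT its cap
  `C(n) ≤ 2^{6n+20}` — by padding the family with the dummy generator `2` (exponent `0`) and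
  choosing `k₀` at a generator of maximal height; whence
  `pasten2024_thm_1_4_1_of_archBound`: Theorem 1.4 (1) from that binder (growth
  `log C(n) ≤ A n log(n+1)`, `n ≥ 2`) and Theorem 2.5.

So the undischarged archimedean input of `pasten2024_thm_1_4_1` is not one particular theorem
but a growth class: any explicit Baker-type bound over `ℚ` in product form whose constant is
`exp(O(n log n))` in the number `n` of logarithms. In the history recounted in
[cite: BakerWustholz2007, §2.8 (pp. 32–34)] this covers Baker–Wüstholz 1993
(`(16nd)^{2(n+2)}`, resp. `C(n, d) = 18 (n+1)! n^{n+1} (32d)^{n+2} log(2nd)` in Theorem 7.1),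
Matveev 2000 (`c^n`), and also the older shape `(16nd)^{200n} Ω log Ω' log B` of Baker 1977
(the extra factor `log Ω' ≤ Ω` is absorbed by `q = 2`); no `p`-adic estimate is involved
(Theorem 2.5 replaces the exponential abc bound, remark 2 of
`BakerMethodBoundsBakerWustholzProofs.lean`). Within this argument a constant `exp(c n²)` would
not give the printed shape `exp(κ √((log R) log₂ R))`: with `n − 1 = #I ≍ (log R)/s` big primes,
`n² ≍ (log R)/log₂ R ≫ s`, and re-optimising the threshold `B = exp s` only yields
`exp(O((log R)^{2/3}))`; hence the growth hypothesis `log C(n) ≤ A n log(n+1)`.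

## The argument (that of §4 and of `BakerMethodBoundsBakerWustholzProofs.lean`, constants generic)

For coprime positive `u, v` with `uv > 1` and a threshold `N`, write `u/v = ξ₀ ∏_{p ∈ I} p^{e_p}`
(`I = bigPrimes u v N`, `ξ₀ = cofactor u v N`). Apply the bound to the `#I + 1` generators
`ξ₀, p (p ∈ I)` with exponents `1, e_p` — except that when `ξ₀ = 1` (not an admissible
generator) it is replaced by the dummy `2` with exponent `0`, which changes neither `x = u/v`
nor `max(h(·), 1) = 1` nor `B`. With `B ≤ log(uv)/log 2` this gives
(`neg_log_abs_one_sub_div_le_of_archProductBound`)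
`−log |1 − u/v| ≤ 1 + C(#I+1) · (max(h(ξ₀),1) ∏_{p∈I} max(log p,1))^q · (1 + log(log(uv)/log 2))`.
For an abc triple with `R = rad(abc)`, `s = s(R) = √((log R) log₂ R)`, `N = ⌊e^s⌋`, Theorem 2.5
gives `#I · s ≤ 4 log R` and `log log c ≤ 5 log R` (file II), so `(log R)^{#I} ≤ e^{4s}`,
`max(h(ξ₀),1) ∏ max(log p, 1) ≤ e^s (log R)(log R)^{#I} ≤ e^{6s}` (`bwHeights_le`),
`1 + log(log(bc)/log 2) ≤ 8 e^s` (`coeffTerm_le`), and the growth hypothesis gives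
`log C(#I+1) ≤ A (#I+1) log(#I+2) ≤ 3A (#I+1) log₂ R ≤ 15 A s` (`log_const_le_of_growth`:
`#I log₂ R ≤ 4 s`, `log₂ R ≤ s`, `log(#I+2) ≤ 2 + log₂ R ≤ 3 log₂ R`). Altogether
`η log c ≤ log(c/a) = −log|1 − b/c| ≤ 1 + 8 e^{(15A+6q+1)s} ≤ e^{(15A+6q+9)s}`.

## References

* [Pasten2024] H. Pasten, Invent. Math. 236 (2024), 373–385, doi:10.1007/s00222-024-01244-6,
  arXiv:2312.03566 — Theorem 1.4 (1) (§1), Theorems 2.1, 2.5 (§2), §4 (the proof).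
* [BakerWustholz2007] A. Baker, G. Wüstholz, *Logarithmic Forms and Diophantine Geometry*, New
  Math. Monogr. 9, CUP 2007 — Thm 7.1 (p. 125); §7.2 (p. 127) on the history of the constants.
* [EvertseGyory2015] J.-H. Evertse, K. Győry, *Unit Equations in Diophantine Number Theory*,
  CUP 2015 — Thm 3.2.4 (p. 61) (Matveev's bound, both expressions of the constant).
* [Matveev2000] E. M. Matveev, Izv. Math. 64 (2000), 1217–1269 — Cor. 2.3.
-/

noncomputable section

open Finset Real Height
open Literature.NumberTheory.DiophantineGeometry
open Literature.NumberTheory.DiophantineGeometry.Pasten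

namespace Literature.Barriers.ABC

/-! ### Small facts -/

/-- `max(h(2), 1) = 1` (`h(2) = log 2 < 1`). [folklore] -/
theorem max_logHeight₁_two_one : max (logHeight₁ (2 : ℚ)) 1 = 1 := by
  have h : logHeight₁ ((2 : ℕ) : ℚ) = Real.log (2 : ℕ) := logHeight₁_natCast_prime Nat.prime_two
  push_cast at h
  rw [h]
  exact max_eq_right (by linarith [Real.log_two_lt_d9])

/-! ### The archimedean step of §4 from a product-form bound with generic constant -/

section Split

variable {u v : ℕ}

/-- **The archimedean step of §4 from ANY product-form bound.** Let `C : ℕ → ℝ≥0`, `q ∈ ℕ`, and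
suppose that for all positive rationals `α₁, …, αₙ ≠ 1`, integers `eᵢ` and
`x = ∏ αᵢ^{eᵢ} ≠ 1` one has `log |log x| > −C(n) (∏ max(h(αᵢ), 1))^q log(e · maxᵢ |eᵢ|)`.
Then for coprime positive `u, v` with `uv > 1` and any threshold `N`, writing
`u/v = ξ₀ ∏_{p ∈ I} p^{e_p}` (`I = bigPrimes u v N`, `ξ₀ = cofactor u v N`):
`−log |1 − u/v| ≤ 1 + C(#I+1) · (max(h(ξ₀),1) ∏_{p∈I} max(log p, 1))^q · (1 + log(log(uv)/log 2))`.
The bound is applied to the family indexed by `Option ↥I`: `p ↦ p` with exponent `e_p`, and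
`none ↦ ξ₀` with exponent `1`, or `none ↦ 2` with exponent `0` when `ξ₀ = 1`; in both cases
`∏ = u/v`, `max(h(α_none), 1) = max(h(ξ₀), 1)` and `B ≤ log(uv)/log 2`
(`2^{|e_p|} ≤ p^{|e_p|} ≤ uv`). [cite: Pasten2024, §4] -/
theorem neg_log_abs_one_sub_div_le_of_archProductBound (C : ℕ → ℝ) (q : ℕ)
    (hC0 : ∀ n, 0 ≤ C n)
    (hA : ∀ (ι : Type) [Fintype ι] (α : ι → ℚ) (e : ι → ℤ) (x : ℚ),
      (∀ i, 0 < α i ∧ α i ≠ 1) → ∏ i, α i ^ e i = x → x ≠ 1 →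
        -(C (Fintype.card ι) * (∏ i, max (logHeight₁ (α i)) 1) ^ q *
            Real.log (Real.exp 1 * (Finset.univ.sup fun i ↦ (e i).natAbs : ℕ))) <
          Real.log |Real.log (x : ℝ)|)
    (hu : u ≠ 0) (hv : v ≠ 0) (huv : u.Coprime v) (h1 : 1 < u * v) (N : ℕ) :
    -Real.log |1 - (u : ℝ) / v| ≤
      1 + C ((bigPrimes u v N).card + 1) *
        (max (logHeight₁ (cofactor u v N)) 1 *
          ∏ p ∈ bigPrimes u v N, max (Real.log p) 1) ^ q *
        (1 + Real.log (Real.log ((u : ℝ) * v) / Real.log 2)) := by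
  classical
  set I := bigPrimes u v N with hI
  set ξ₀ := cofactor u v N with hξ₀
  set x : ℚ := (u : ℚ) / v with hxdef
  -- the family: `ξ₀` (or the dummy `2` when `ξ₀ = 1`) and `p ∈ I`
  set α : Option ↥I → ℚ := fun o => o.elim (if ξ₀ = 1 then 2 else ξ₀) fun p => ((p : ℕ) : ℚ)
    with hα
  set e : Option ↥I → ℤ := fun o => o.elim (if ξ₀ = 1 then 0 else 1) fun p => expDiff u v p
    with he
  have hpos : ∀ o, 0 < α o ∧ α o ≠ 1 := by
    rintro (_ | p)
    · simp only [hα, Option.elim_none]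
      split_ifs with h
      · norm_num
      · exact ⟨cofactor_pos u v N, h⟩
    · simp only [hα, Option.elim_some]
      have hp := prime_of_mem_bigPrimes p.2
      exact ⟨by exact_mod_cast hp.pos, by exact_mod_cast hp.one_lt.ne'⟩
  have h0 : (if ξ₀ = 1 then (2 : ℚ) else ξ₀) ^ (if ξ₀ = 1 then (0 : ℤ) else 1) = ξ₀ := by
    split_ifs with h
    · rw [zpow_zero, h]
    · exact zpow_one _
  have hx : ∏ o, α o ^ e o = x := by
    rw [Fintype.prod_option]
    simp only [hα, he, Option.elim_none, Option.elim_some]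
    rw [h0, hxdef, cast_div_eq_cofactor_mul_prod hu hv huv N, ← Finset.prod_coe_sort I]
  have hx1 : x ≠ 1 := cast_div_ne_one hv huv h1
  have key := hA (Option ↥I) α e x hpos hx hx1
  -- identify the pieces
  have hcard : Fintype.card (Option ↥I) = I.card + 1 := by
    rw [Fintype.card_option, Fintype.card_coe]
  have hnone : max (logHeight₁ (if ξ₀ = 1 then (2 : ℚ) else ξ₀)) 1 = max (logHeight₁ ξ₀) 1 := by
    split_ifs with h
    · rw [max_logHeight₁_two_one, h, logHeight₁_one, max_eq_right zero_le_one]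
    · rfl
  have hprod : ∏ o, max (logHeight₁ (α o)) 1 =
      max (logHeight₁ ξ₀) 1 * ∏ p ∈ I, max (Real.log p) 1 := by
    rw [Fintype.prod_option]
    simp only [hα, Option.elim_none, Option.elim_some]
    rw [hnone, ← Finset.prod_coe_sort I]
    congr 1
    exact Finset.prod_congr rfl fun p _ => by
      rw [logHeight₁_natCast_prime (prime_of_mem_bigPrimes p.2)]
  have hcastx : ((x : ℚ) : ℝ) = (u : ℝ) / v := by rw [hxdef]; push_cast; rfl
  rw [hcard, hprod, hcastx] at key
  -- the size of the coefficients: `B ≤ log(uv)/log 2`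
  set B : ℕ := Finset.univ.sup fun o ↦ (e o).natAbs with hB
  have huv2 : (2 : ℝ) ≤ (u : ℝ) * v := by exact_mod_cast h1
  have hlog2 : 0 < Real.log 2 := Real.log_pos (by norm_num)
  have hloguv : Real.log 2 ≤ Real.log ((u : ℝ) * v) := Real.log_le_log (by norm_num) huv2
  have hBle : (B : ℝ) * Real.log 2 ≤ Real.log ((u : ℝ) * v) := by
    obtain ⟨o, -, ho⟩ := Finset.exists_mem_eq_sup (Finset.univ : Finset (Option ↥I))
      Finset.univ_nonempty (fun o ↦ (e o).natAbs)
    rw [hB, ho]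
    rcases o with _ | p
    · simp only [he, Option.elim_none]
      split_ifs
      · simp only [Int.natAbs_zero, Nat.cast_zero, zero_mul]
        linarith
      · simpa using hloguv
    · simp only [he, Option.elim_some]
      exact natAbs_expDiff_mul_log_two_le hu hv huv (prime_of_mem_bigPrimes p.2)
  have hBle' : (B : ℝ) ≤ Real.log ((u : ℝ) * v) / Real.log 2 := by
    rw [le_div_iff₀ hlog2]; exact hBle
  have hQ1 : 1 ≤ Real.log ((u : ℝ) * v) / Real.log 2 := by
    rw [le_div_iff₀ hlog2, one_mul]; exact hloguv
  have hlogB : Real.log (Real.exp 1 * (B : ℝ)) ≤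
      1 + Real.log (Real.log ((u : ℝ) * v) / Real.log 2) := by
    have hQ0 := Real.log_nonneg hQ1
    rcases Nat.eq_zero_or_pos B with hB0 | hB0
    · rw [hB0, Nat.cast_zero, mul_zero, Real.log_zero]
      linarith
    · have hB0' : (0 : ℝ) < B := by exact_mod_cast hB0
      rw [Real.log_mul (Real.exp_pos 1).ne' hB0'.ne', Real.log_exp]
      have := Real.log_le_log hB0' hBle'
      linarith
  -- positivity of the factors
  have hC : 0 ≤ C (I.card + 1) := hC0 _
  have hH : 0 ≤ (max (logHeight₁ ξ₀) 1 * ∏ p ∈ I, max (Real.log p) 1) ^ q :=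
    pow_nonneg (mul_nonneg (le_trans zero_le_one (le_max_right _ _))
      (Finset.prod_nonneg fun p _ => le_trans zero_le_one (le_max_right _ _))) q
  have hT : 0 ≤ 1 + Real.log (Real.log ((u : ℝ) * v) / Real.log 2) := by
    have := Real.log_nonneg hQ1; linarith
  set M := C (I.card + 1) * (max (logHeight₁ ξ₀) 1 * ∏ p ∈ I, max (Real.log p) 1) ^ q *
    (1 + Real.log (Real.log ((u : ℝ) * v) / Real.log 2)) with hM
  have hM0 : 0 ≤ M := mul_nonneg (mul_nonneg hC hH) hT
  have hkeyM : -Real.log |Real.log ((u : ℝ) / v)| ≤ M := by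
    have h2 : C (I.card + 1) * (max (logHeight₁ ξ₀) 1 * ∏ p ∈ I, max (Real.log p) 1) ^ q *
        Real.log (Real.exp 1 * (B : ℝ)) ≤ M :=
      mul_le_mul_of_nonneg_left hlogB (mul_nonneg hC hH)
    linarith
  -- from `|log x|` to `|1 - x|`
  have hxpos : (0 : ℝ) < (u : ℝ) / v := by
    have hu' : (0 : ℝ) < u := by exact_mod_cast Nat.pos_of_ne_zero hu
    have hv' : (0 : ℝ) < v := by exact_mod_cast Nat.pos_of_ne_zero hv
    positivity
  have hx1' : (u : ℝ) / v ≠ 1 := by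
    intro h
    apply hx1
    have : ((x : ℚ) : ℝ) = ((1 : ℚ) : ℝ) := by rw [hcastx, h]; push_cast; rfl
    exact_mod_cast this
  have hA' := neg_log_abs_one_sub_le_of_pos hxpos hx1'
  have hmax : max 0 (-Real.log |Real.log ((u : ℝ) / v)|) ≤ M := max_le hM0 hkeyM
  linarith

end Split

/-! ### Accounting of a constant of growth `log C(n) ≤ A n log(n+1)` -/

section Accounting

variable {R : ℝ}

/-- The accounting of the constant: if `log R ≥ e`, `k · s(R) ≤ 4 log R` and
`log C ≤ A (k+1) log(k+2)` with `A ≥ 0`, then `log C ≤ 15 A · s(R)`. Indeed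
`k + 2 ≤ 6 log R` gives `log(k+2) ≤ 2 + log₂ R ≤ 3 log₂ R`, and `s² = (log R) log₂ R`,
`log₂ R ≤ s ≤ log R` give `(k+1) log₂ R ≤ 5 s`. So any constant `exp(O(n log n))` in the number
`n = #I + 1` of logarithms is `exp(O(s))` on Pasten's splitting. [cite: Pasten2024, §4] -/
theorem log_const_le_of_growth (hL : Real.exp 1 ≤ Real.log R) {k : ℕ}
    (hk : (k : ℝ) * sfun R ≤ 4 * Real.log R) {A c : ℝ} (hA : 0 ≤ A)
    (hc : Real.log c ≤ A * ((k + 1 : ℕ) : ℝ) * Real.log (((k + 1 : ℕ) : ℝ) + 1)) :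
    Real.log c ≤ 15 * A * sfun R := by
  have hL1 := one_le_log_of_exp_le hL
  have hℓ1 := one_le_loglog hL
  have hs1 := one_le_sfun hL
  have hs := sfun_pos hL
  have hsL := sfun_le_log hL
  have hsq := sfun_sq hL
  obtain ⟨-, h6⟩ := log_thirtyTwo_le_and_log_six_le
  have hk0 : (0 : ℝ) ≤ k := Nat.cast_nonneg k
  have hcast : (((k + 1 : ℕ) : ℝ)) = (k : ℝ) + 1 := by push_cast; ring
  rw [hcast] at hc
  have hcast2 : (k : ℝ) + 1 + 1 = (k : ℝ) + 2 := by ring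
  rw [hcast2] at hc
  -- `log (k+2) ≤ 2 + log₂ R ≤ 3 log₂ R`
  have h2 : Real.log ((k : ℝ) + 2) ≤ 3 * Real.log (Real.log R) := by
    have hk2s : (k : ℝ) + 2 ≤ 6 * Real.log R := by
      calc (k : ℝ) + 2 ≤ ((k : ℝ) + 2) * sfun R := le_mul_of_one_le_right (by linarith) hs1
        _ = (k : ℝ) * sfun R + 2 * sfun R := by ring
        _ ≤ 4 * Real.log R + 2 * Real.log R := by linarith
        _ = 6 * Real.log R := by ring
    have hLpos : 0 < Real.log R := by linarith
    calc Real.log ((k : ℝ) + 2) ≤ Real.log (6 * Real.log R) := Real.log_le_log (by linarith) hk2s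
      _ = Real.log 6 + Real.log (Real.log R) := Real.log_mul (by norm_num) hLpos.ne'
      _ ≤ 3 * Real.log (Real.log R) := by linarith
  -- `(k+1) log₂ R ≤ 5 s`
  have h3 : ((k : ℝ) + 1) * Real.log (Real.log R) ≤ 5 * sfun R := by
    refine le_of_mul_le_mul_right ?_ hs
    have hℓ0 : 0 ≤ Real.log (Real.log R) := le_trans zero_le_one hℓ1
    have hℓs : Real.log (Real.log R) ≤ sfun R := loglog_le_sfun hL
    calc ((k : ℝ) + 1) * Real.log (Real.log R) * sfun R
        = ((k : ℝ) * sfun R) * Real.log (Real.log R) + Real.log (Real.log R) * sfun R := by ring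
      _ ≤ (4 * Real.log R) * Real.log (Real.log R) + sfun R * sfun R := by
          have := mul_le_mul_of_nonneg_right hk hℓ0
          have := mul_le_mul_of_nonneg_right hℓs hs.le
          linarith
      _ = 5 * sfun R * sfun R := by
          have h' : sfun R * sfun R = Real.log R * Real.log (Real.log R) := by rw [← sq, hsq]
          linarith [h']
  have hlog0 : 0 ≤ Real.log ((k : ℝ) + 2) := Real.log_nonneg (by linarith)
  calc Real.log c ≤ A * ((k : ℝ) + 1) * Real.log ((k : ℝ) + 2) := hc
    _ ≤ A * ((k : ℝ) + 1) * (3 * Real.log (Real.log R)) :=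
        mul_le_mul_of_nonneg_left h2 (by positivity)
    _ = 3 * A * (((k : ℝ) + 1) * Real.log (Real.log R)) := by ring
    _ ≤ 3 * A * (5 * sfun R) := mul_le_mul_of_nonneg_left h3 (by positivity)
    _ = 15 * A * sfun R := by ring

end Accounting

/-! ### Assembly: Theorem 1.4 (1) from a product-form bound and Theorem 2.5 -/

section Assembly

variable {a b c : ℕ}

/-- The assembly for a NONNEGATIVE constant `C` of growth `log C(n) ≤ A n log(n+1)` (`n ≥ 1`,
`A ≥ 0`): Theorem 1.4 (1) with `κ = 15A + 6q + 9` and threshold `log R ≥ max(e, log k₁)` from the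
product-form bound and Theorem 2.5. See `pasten2024_thm_1_4_1_of_archProductBound` for the
statement without sign conditions. [cite: Pasten2024, Theorem 1.4 (1) and §4] -/
theorem pasten2024_thm_1_4_1_of_archProductBound_of_nonneg (C : ℕ → ℝ) (q : ℕ) {A : ℝ}
    (hA0 : 0 ≤ A) (hC0 : ∀ n, 0 ≤ C n)
    (hC : ∀ n : ℕ, 1 ≤ n → Real.log (C n) ≤ A * n * Real.log (n + 1))
    (hA : ∀ (ι : Type) [Fintype ι] (α : ι → ℚ) (e : ι → ℤ) (x : ℚ),
      (∀ i, 0 < α i ∧ α i ≠ 1) → ∏ i, α i ^ e i = x → x ≠ 1 →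
        -(C (Fintype.card ι) * (∏ i, max (logHeight₁ (α i)) 1) ^ q *
            Real.log (Real.exp 1 * (Finset.univ.sup fun i ↦ (e i).natAbs : ℕ))) <
          Real.log |Real.log (x : ℝ)|)
    (h25 : pasten2024_thm_2_5) : pasten2024_thm_1_4_1 := by
  obtain ⟨κ₁, hκ₁⟩ := h25 (1 / 3) (by norm_num)
  set k₁ : ℝ := max κ₁ 1 with hk₁def
  set L₀ : ℝ := max (Real.exp 1) (Real.log k₁) with hL₀def
  have hk₁ : 1 ≤ k₁ := le_max_right _ _
  set κ : ℝ := 15 * A + 6 * q + 9 with hκdef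
  have hq0 : (0 : ℝ) ≤ q := Nat.cast_nonneg q
  have hκ : 0 < κ := by rw [hκdef]; positivity
  refine ⟨κ, hκ, Real.exp L₀, ?_⟩
  intro a b c ht hR₀ η hη haη
  show Real.log c ≤ η⁻¹ * Real.exp (κ * sfun (rad a b c : ℝ))
  set R : ℝ := (rad a b c : ℝ) with hRdef
  have hR1 : 1 ≤ R := one_le_rad_real a b c
  have hR : 0 < R := lt_of_lt_of_le one_pos hR1
  have hL₀L : L₀ ≤ Real.log R := (Real.le_log_iff_exp_le hR).mpr hR₀
  have hL : Real.exp 1 ≤ Real.log R := le_trans (le_max_left _ _) hL₀L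
  have hk₁L : Real.log k₁ ≤ Real.log R := le_trans (le_max_right _ _) hL₀L
  have hL1 := one_le_log_of_exp_le hL
  have hL0 : 0 ≤ Real.log R := le_trans zero_le_one hL1
  set s := sfun R with hsdef
  have hs := sfun_pos hL
  have hs1 := one_le_sfun hL
  set N := ⌊Real.exp s⌋₊ with hNdef
  obtain ⟨ha0, hb0, hc0⟩ := abc_ne_zero ht
  obtain ⟨hbc, -, h1bc⟩ := abc_coprime_aux ht
  -- Step 1: `η log c ≤ −log |1 − b/c|`
  have step1 : η * Real.log c ≤ -Real.log |1 - (b : ℝ) / c| := eta_mul_log_le ht haη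
  -- Step 2: the product-form bound on the splitting of `b/c`
  have step2 := neg_log_abs_one_sub_div_le_of_archProductBound C q hC0 hA hb0 hc0 hbc h1bc N
  set n := (bigPrimes b c N).card with hndef
  set H := max (logHeight₁ (cofactor b c N)) 1 *
    ∏ p ∈ bigPrimes b c N, max (Real.log p) 1 with hHdef
  set T := 1 + Real.log (Real.log ((b : ℝ) * c) / Real.log 2) with hTdef
  -- Step 3: `H ≤ B (log R) (log R)^n`
  have step3 : H ≤ Real.exp s * Real.log R * Real.log R ^ n := bwHeights_le ht hL
  -- Step 4: `n s ≤ 4 log R` (Theorem 2.5), hence `(log R)^n ≤ exp(4 s)`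
  have hE : (exponentProduct (a * b * c) : ℝ) ≤ k₁ * R ^ 3 := by
    have h := hκ₁ a b c ht
    have h3 : R ^ (8 / 3 + 1 / 3 : ℝ) = R ^ 3 := by
      rw [show (8 / 3 + 1 / 3 : ℝ) = ((3 : ℕ) : ℝ) by norm_num, Real.rpow_natCast]
    rw [h3] at h
    exact h.trans (mul_le_mul_of_nonneg_right (le_max_left _ _) (by positivity))
  have step4a : (n : ℝ) * s ≤ 4 * Real.log R := card_bigPrimes_mul_sfun_le ht hk₁ hE hk₁L
  have step4 : Real.log R ^ n ≤ Real.exp (4 * s) := by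
    have h := mul_log_pow_le_exp le_rfl hL step4a
    simpa [Real.log_one] using h
  -- Step 5: `C(n+1) ≤ exp(15 A s)`
  have step5 : C (n + 1) ≤ Real.exp (15 * A * s) := by
    have h := log_const_le_of_growth hL step4a hA0 (hC (n + 1) (by omega))
    exact (Real.le_exp_log _).trans (Real.exp_le_exp.mpr h)
  -- Step 6: `T ≤ 8 log R ≤ 8 B`
  have hLB : Real.log R ≤ Real.exp s := log_le_exp_sfun hL
  have step6 : T ≤ 8 * Real.exp s :=
    (coeffTerm_le ht hk₁ hE hk₁L hL1).trans (by linarith)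
  -- Step 7: `H^q ≤ exp(6 q s)`
  have hH0 : 0 ≤ H := mul_nonneg (le_trans zero_le_one (le_max_right _ _))
    (Finset.prod_nonneg fun p _ => le_trans zero_le_one (le_max_right _ _))
  have hH6 : H ≤ Real.exp (6 * s) :=
    calc H ≤ Real.exp s * Real.log R * Real.log R ^ n := step3
      _ ≤ Real.exp s * Real.exp s * Real.exp (4 * s) :=
          mul_le_mul (mul_le_mul_of_nonneg_left hLB (by positivity)) step4 (by positivity)
            (by positivity)
      _ = Real.exp (6 * s) := by simp only [← Real.exp_add]; congr 1; ring
  have step7 : H ^ q ≤ Real.exp (6 * q * s) :=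
    calc H ^ q ≤ Real.exp (6 * s) ^ q := pow_le_pow_left₀ hH0 hH6 q
      _ = Real.exp (6 * q * s) := by rw [← Real.exp_nat_mul]; congr 1; ring
  -- nonnegativity
  have hT0 : 0 ≤ T := by
    have hbc2 : (2 : ℝ) ≤ (b : ℝ) * c := by exact_mod_cast h1bc
    have hlog2 : 0 < Real.log 2 := Real.log_pos (by norm_num)
    have hQ1 : 1 ≤ Real.log ((b : ℝ) * c) / Real.log 2 := by
      rw [le_div_iff₀ hlog2, one_mul]
      exact Real.log_le_log (by norm_num) hbc2
    have := Real.log_nonneg hQ1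
    rw [hTdef]; linarith
  have hHq0 : 0 ≤ H ^ q := pow_nonneg hH0 q
  -- combine
  have main : η * Real.log c ≤ Real.exp (κ * s) :=
    calc η * Real.log c ≤ 1 + C (n + 1) * H ^ q * T := step1.trans step2
      _ ≤ 1 + Real.exp (15 * A * s) * Real.exp (6 * q * s) * (8 * Real.exp s) := by
          have := mul_le_mul (mul_le_mul step5 step7 hHq0 (by positivity)) step6 hT0
            (by positivity)
          linarith
      _ = 1 + 8 * Real.exp ((15 * A + 6 * q + 1) * s) := by
          have : Real.exp ((15 * A + 6 * q + 1) * s) =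
              Real.exp (15 * A * s) * Real.exp (6 * q * s) * Real.exp s := by
            simp only [← Real.exp_add]; congr 1; ring
          rw [this]; ring
      _ ≤ 9 * Real.exp ((15 * A + 6 * q + 1) * s) := by
          have h0 : (0 : ℝ) ≤ (15 * A + 6 * q + 1) * s := by positivity
          linarith [Real.one_le_exp h0]
      _ ≤ Real.exp (8 * s) * Real.exp ((15 * A + 6 * q + 1) * s) := by
          apply mul_le_mul_of_nonneg_right _ (by positivity)
          linarith [Real.add_one_le_exp (8 * s)]
      _ = Real.exp (κ * s) := by rw [← Real.exp_add, hκdef]; congr 1; ring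
  calc Real.log c = η⁻¹ * (η * Real.log c) := by field_simp
    _ ≤ η⁻¹ * Real.exp (κ * s) := mul_le_mul_of_nonneg_left main (inv_pos.mpr hη).le

/-- **Pasten's Theorem 1.4 (1) from ANY product-form archimedean bound and Theorem 2.5.**
Let `C : ℕ → ℝ` and `q ∈ ℕ`, and suppose:
* (growth) `log C(n) ≤ A · n · log(n + 1)` for all `n ≥ 1`, for some real `A`;
* (bound) for every finite family of positive rationals `αᵢ ≠ 1` (`n` of them) and integers
  `eᵢ` with `x = ∏ αᵢ^{eᵢ} ≠ 1`:
  `log |log x| > −C(n) · (∏ᵢ max(h(αᵢ), 1))^q · log(e · maxᵢ |eᵢ|)`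
  (`h` the absolute logarithmic Weil height; `log x = ∑ eᵢ log αᵢ` is the linear form);
* Theorem 2.5 of the source (`pasten2024_thm_2_5`).
Then `pasten2024_thm_1_4_1` holds (with `κ = 15 max(A, 0) + 6q + 9`). Baker–Wüstholz 1993
(`q = 1`, `C = C(n, 1)`, `A = 42`: `archProductBound_of_bakerWustholz`,
`log_bwConstant_one_le_growth`) and every bound of Matveev's shape with constant
`exp(O(n log n))` (`archProductBound_of_archBound`) are instances. The source's own input,
Theorem 2.1 (i), has `K^m log max{e, h(ξ)} ∏ h(ξⱼ)` instead and is treated in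
`BakerMethodBoundsProofs.lean`. A possibly negative `C` is replaced by `max(C, 0)`.
[cite: Pasten2024, Theorem 1.4 (1) and §4] -/
theorem pasten2024_thm_1_4_1_of_archProductBound (C : ℕ → ℝ) (q : ℕ) (A : ℝ)
    (hC : ∀ n : ℕ, 1 ≤ n → Real.log (C n) ≤ A * n * Real.log (n + 1))
    (hA : ∀ (ι : Type) [Fintype ι] (α : ι → ℚ) (e : ι → ℤ) (x : ℚ),
      (∀ i, 0 < α i ∧ α i ≠ 1) → ∏ i, α i ^ e i = x → x ≠ 1 →
        -(C (Fintype.card ι) * (∏ i, max (logHeight₁ (α i)) 1) ^ q *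
            Real.log (Real.exp 1 * (Finset.univ.sup fun i ↦ (e i).natAbs : ℕ))) <
          Real.log |Real.log (x : ℝ)|)
    (h25 : pasten2024_thm_2_5) : pasten2024_thm_1_4_1 := by
  classical
  set C' : ℕ → ℝ := fun n => max (C n) 0 with hC'
  have hA0 : 0 ≤ max A 0 := le_max_right _ _
  refine pasten2024_thm_1_4_1_of_archProductBound_of_nonneg C' q hA0 (fun n => le_max_right _ _)
    ?_ ?_ h25
  · -- growth of `max(C, 0)`
    intro n hn
    have hn0 : (0 : ℝ) ≤ n := Nat.cast_nonneg n
    have hlog : 0 ≤ Real.log ((n : ℝ) + 1) := Real.log_nonneg (by linarith)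
    have hrhs : A * n * Real.log (n + 1) ≤ max A 0 * n * Real.log (n + 1) :=
      mul_le_mul_of_nonneg_right (mul_le_mul_of_nonneg_right (le_max_left _ _) hn0) hlog
    simp only [hC']
    rcases le_or_gt (C n) 0 with h | h
    · rw [max_eq_right h, Real.log_zero]
      positivity
    · rw [max_eq_left h.le]
      exact (hC n hn).trans hrhs
  · -- the bound for `max(C, 0)`
    intro ι _ α e x hα hx hx1
    have key := hA ι α e x hα hx hx1
    refine lt_of_le_of_lt (neg_le_neg ?_) key
    have hP : 0 ≤ (∏ i, max (logHeight₁ (α i)) 1) ^ q :=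
      pow_nonneg (Finset.prod_nonneg fun i _ => le_trans zero_le_one (le_max_right _ _)) q
    have hlogB : 0 ≤ Real.log (Real.exp 1 * ((Finset.univ.sup fun i ↦ (e i).natAbs : ℕ) : ℝ)) := by
      rcases Nat.eq_zero_or_pos (Finset.univ.sup fun i ↦ (e i).natAbs) with h0 | h0
      · rw [h0, Nat.cast_zero, mul_zero, Real.log_zero]
      · apply Real.log_nonneg
        have h1 : (1 : ℝ) ≤ ((Finset.univ.sup fun i ↦ (e i).natAbs : ℕ) : ℝ) := by
          exact_mod_cast h0
        nlinarith [Real.add_one_le_exp (1 : ℝ)]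
    exact mul_le_mul_of_nonneg_right (mul_le_mul_of_nonneg_right (le_max_left _ _) hP) hlogB

end Assembly

/-! ### Instances: Baker–Wüstholz 1993, and any bound of Matveev's shape -/

section Instances

/-- Baker–Wüstholz 1993 over `ℚ` is a product-form bound with `q = 1` and `C = C(·, 1)`:
`baker_wustholz ℚ` specialised to positive rationals (`bakerWustholz_rat_of_pos`).
[cite: BakerWustholz2007, Thm 7.1 (p. 125)] -/
theorem archProductBound_of_bakerWustholz (hBW : baker_wustholz ℚ) :
    ∀ (ι : Type) [Fintype ι] (α : ι → ℚ) (e : ι → ℤ) (x : ℚ),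
      (∀ i, 0 < α i ∧ α i ≠ 1) → ∏ i, α i ^ e i = x → x ≠ 1 →
        -((fun n => bwConstant n 1) (Fintype.card ι) * (∏ i, max (logHeight₁ (α i)) 1) ^ 1 *
            Real.log (Real.exp 1 * (Finset.univ.sup fun i ↦ (e i).natAbs : ℕ))) <
          Real.log |Real.log (x : ℝ)| := by
  intro ι _ α e x hα hx hx1
  rw [pow_one]
  exact bakerWustholz_rat_of_pos hBW α e (fun i => (hα i).1) hx hx1

/-- The growth of the Baker–Wüstholz constant for `d = 1`: `log C(n, 1) ≤ 42 n log(n+1)` for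
`n ≥ 1` (from `C(n, 1) ≤ (32(n+1))^{2n+4}`: `2n + 4 ≤ 6n`, `log 32 ≤ 4 ≤ 6 log(n+1)`).
[folklore] -/
theorem log_bwConstant_one_le_growth (n : ℕ) (hn : 1 ≤ n) :
    Real.log (bwConstant n 1) ≤ 42 * n * Real.log (n + 1) := by
  have hC : 0 < bwConstant n 1 := bwConstant_pos hn le_rfl
  have hn1 : (1 : ℝ) ≤ n := by exact_mod_cast hn
  obtain ⟨h32, -⟩ := log_thirtyTwo_le_and_log_six_le
  have hlog2 : Real.log 2 ≤ Real.log ((n : ℝ) + 1) := Real.log_le_log (by norm_num) (by linarith)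
  have hl2 := Real.log_two_gt_d9
  have hlog1 : 4 ≤ 6 * Real.log ((n : ℝ) + 1) := by nlinarith
  have hlog0 : 0 ≤ Real.log ((n : ℝ) + 1) := by linarith
  have h32pos : 0 ≤ Real.log 32 := Real.log_nonneg (by norm_num)
  have hsum : Real.log 32 + Real.log ((n : ℝ) + 1) ≤ 7 * Real.log ((n : ℝ) + 1) := by linarith
  have hsum0 : 0 ≤ Real.log 32 + Real.log ((n : ℝ) + 1) := by linarith
  have hexp : ((2 * n + 4 : ℕ) : ℝ) ≤ 6 * n := by push_cast; linarith
  calc Real.log (bwConstant n 1) ≤ Real.log ((32 * ((n : ℝ) + 1)) ^ (2 * n + 4)) :=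
        Real.log_le_log hC (bwConstant_one_le_pow n)
    _ = (2 * n + 4 : ℕ) * (Real.log 32 + Real.log ((n : ℝ) + 1)) := by
        rw [Real.log_pow, Real.log_mul (by norm_num) (by linarith)]
    _ ≤ (6 * n : ℝ) * (7 * Real.log ((n : ℝ) + 1)) :=
        mul_le_mul hexp hsum hsum0 (by positivity)
    _ = 42 * n * Real.log (n + 1) := by ring

/-- `pasten2024_thm_1_4_1_of_bakerWustholz` recovered from the generic theorem (`q = 1`,
`A = 42`, so `κ = 15 · 42 + 6 + 9 = 645`; the direct accounting of file II gives `κ = 113`). -/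
example (hBW : baker_wustholz ℚ) (h25 : pasten2024_thm_2_5) : pasten2024_thm_1_4_1 :=
  pasten2024_thm_1_4_1_of_archProductBound (fun n => bwConstant n 1) 1 42
    log_bwConstant_one_le_growth (archProductBound_of_bakerWustholz hBW) h25

/-- **Any bound of Matveev's shape is a product-form bound.** Suppose that for every `n ≥ 2`
positive rationals `a₁, …, aₙ ≠ 1`, `b ∈ ℤⁿ ∖ {0}` with `Σ = ∑ bₖ log aₖ ≠ 0`, reals
`Aₖ ≥ max{h(aₖ), |log aₖ|, 0.16}`, an index `k₀` and `B ≥ 1` with `|bₖ| Aₖ / A_{k₀} ≤ B` for all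
`k`, one has `log |Σ| > −C(n) A₁⋯Aₙ log(eB)` — the statement of Evertse–Győry's Theorem 3.2.4
for `K = ℚ` [cite: EvertseGyory2015, Thm 3.2.4 (p. 61)] with a generic constant, verbatim the
hypothesis `hM` of `Dioph.thm328_rat_infinite_of_archBound`. Then the product-form bound of
`pasten2024_thm_1_4_1_of_archProductBound` holds with `q = 1` and constant `C(n + 1)`: given
positive rationals `αᵢ ≠ 1` (`n ≥ 1` of them, as `x ≠ 1`) apply the hypothesis to the `n + 1`
numbers `2, αᵢ` with coefficients `0, eᵢ`, `Aₖ = max(h(aₖ), 1)` (admissible as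
`|log α| ≤ h(α)` for positive rationals, `abs_log_le_logHeight₁`), `k₀` of maximal `Aₖ` (so
`|bₖ| Aₖ / A_{k₀} ≤ |bₖ| ≤ B = max |eᵢ|`, and `B ≥ 1` as some `eᵢ ≠ 0`); `max(h(2), 1) = 1`.
[cite: EvertseGyory2015, Thm 3.2.4 (p. 61)] [cite: Pasten2024, §4] -/
theorem archProductBound_of_archBound (C : ℕ → ℝ)
    (hM : ∀ (κ : Type) [Fintype κ], 2 ≤ Fintype.card κ →
      ∀ (a : κ → ℚ) (b : κ → ℤ) (A : κ → ℝ) (k₀ : κ) (B : ℝ),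
        (∀ k, 0 < a k ∧ a k ≠ 1) → b ≠ 0 →
        ∑ k, (b k : ℝ) * Real.log (a k : ℝ) ≠ 0 →
        (∀ k, max (logHeight₁ (a k)) (max |Real.log (a k : ℝ)| 0.16) ≤ A k) →
        1 ≤ B → (∀ k, (|b k| : ℝ) * A k / A k₀ ≤ B) →
        -(C (Fintype.card κ) * (∏ k, A k) * Real.log (Real.exp 1 * B)) <
          Real.log |∑ k, (b k : ℝ) * Real.log (a k : ℝ)|) :
    ∀ (ι : Type) [Fintype ι] (α : ι → ℚ) (e : ι → ℤ) (x : ℚ),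
      (∀ i, 0 < α i ∧ α i ≠ 1) → ∏ i, α i ^ e i = x → x ≠ 1 →
        -((fun n => C (n + 1)) (Fintype.card ι) * (∏ i, max (logHeight₁ (α i)) 1) ^ 1 *
            Real.log (Real.exp 1 * (Finset.univ.sup fun i ↦ (e i).natAbs : ℕ))) <
          Real.log |Real.log (x : ℝ)| := by
  intro ι _ α e x hα hx hx1
  classical
  rw [pow_one]
  -- the padded family on `Option ι`
  set a : Option ι → ℚ := fun o => o.elim 2 α with ha
  set b : Option ι → ℤ := fun o => o.elim 0 e with hb
  set A : Option ι → ℝ := fun o => max (logHeight₁ (a o)) 1 with hAdef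
  set B : ℕ := Finset.univ.sup fun i ↦ (e i).natAbs with hBdef
  -- some exponent is nonzero (else `x = 1`)
  have hex : ∃ i, e i ≠ 0 := by
    by_contra h
    apply hx1
    rw [← hx]
    exact Finset.prod_eq_one fun i _ => by rw [not_not.mp (not_exists.mp h i), zpow_zero]
  obtain ⟨i₀, hi₀⟩ := hex
  have hB1 : 1 ≤ B := by
    have h1 : 1 ≤ (e i₀).natAbs := Int.natAbs_pos.mpr hi₀
    exact h1.trans (Finset.le_sup (f := fun i ↦ (e i).natAbs) (Finset.mem_univ i₀))
  have hB1' : (1 : ℝ) ≤ (B : ℝ) := by exact_mod_cast hB1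
  -- cardinality
  have hcard : Fintype.card (Option ι) = Fintype.card ι + 1 := Fintype.card_option
  have hcard2 : 2 ≤ Fintype.card (Option ι) := by
    rw [hcard]
    have : 0 < Fintype.card ι := Fintype.card_pos_iff.mpr ⟨i₀⟩
    omega
  -- hypotheses of `hM`
  have hapos : ∀ o, 0 < a o ∧ a o ≠ 1 := by
    rintro (_ | i)
    · simp only [ha, Option.elim_none]; norm_num
    · exact hα i
  have hb0 : b ≠ 0 := by
    intro h
    have : b (some i₀) = 0 := by rw [h]; rfl
    exact hi₀ (by simpa [hb] using this)
  have hxpos : (0 : ℝ) < x := by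
    rw [← hx]; push_cast
    exact Finset.prod_pos fun i _ => zpow_pos (by exact_mod_cast (hα i).1) _
  have hlogx : Real.log (x : ℝ) = ∑ i, (e i : ℝ) * Real.log (α i : ℝ) := by
    rw [← hx]; push_cast
    rw [Real.log_prod fun i _ => (zpow_pos (by exact_mod_cast (hα i).1) _).ne']
    exact Finset.sum_congr rfl fun i _ => Real.log_zpow _ _
  have hsum : ∑ o, (b o : ℝ) * Real.log (a o : ℝ) = Real.log (x : ℝ) := by
    rw [Fintype.sum_option]
    simp only [hb, ha, Option.elim_none, Option.elim_some, Int.cast_zero, zero_mul, zero_add]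
    exact hlogx.symm
  have hS : ∑ o, (b o : ℝ) * Real.log (a o : ℝ) ≠ 0 := by
    rw [hsum]
    exact Real.log_ne_zero_of_pos_of_ne_one hxpos (by exact_mod_cast hx1)
  have hAk : ∀ o, max (logHeight₁ (a o)) (max |Real.log (a o : ℝ)| 0.16) ≤ A o := by
    intro o
    refine max_le (le_max_left _ _) (max_le ?_ ?_)
    · exact (abs_log_le_logHeight₁ (hapos o).1).trans (le_max_left _ _)
    · exact le_trans (by norm_num) (le_max_right _ _)
  -- `k₀` of maximal `A`
  obtain ⟨k₀, -, hk₀⟩ := Finset.exists_max_image (Finset.univ : Finset (Option ι)) A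
    ⟨none, Finset.mem_univ _⟩
  have hA1 : ∀ o, 1 ≤ A o := fun o => le_max_right _ _
  have hAk₀ : 0 < A k₀ := lt_of_lt_of_le one_pos (hA1 k₀)
  have hratio : ∀ o, (|b o| : ℝ) * A o / A k₀ ≤ B := by
    intro o
    have hle : A o ≤ A k₀ := hk₀ o (Finset.mem_univ o)
    have hbo : (|b o| : ℝ) ≤ B := by
      rcases o with _ | i
      · simp only [hb, Option.elim_none, Int.cast_zero, abs_zero]
        exact le_trans zero_le_one hB1'
      · simp only [hb, Option.elim_some]
        have h1 : (e i).natAbs ≤ B := Finset.le_sup (f := fun i ↦ (e i).natAbs) (Finset.mem_univ i)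
        have h2 : ((e i).natAbs : ℝ) ≤ B := by exact_mod_cast h1
        rw [Nat.cast_natAbs, Int.cast_abs] at h2
        exact h2
    rw [div_le_iff₀ hAk₀]
    calc (|b o| : ℝ) * A o ≤ |(b o : ℝ)| * A k₀ :=
          mul_le_mul_of_nonneg_left hle (abs_nonneg _)
      _ ≤ B * A k₀ := mul_le_mul_of_nonneg_right hbo hAk₀.le
  have key := hM (Option ι) hcard2 a b A k₀ B hapos hb0 hS hAk hB1' hratio
  -- identify the pieces
  have hprod : ∏ o, A o = ∏ i, max (logHeight₁ (α i)) 1 := by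
    rw [Fintype.prod_option]
    simp only [hAdef, ha, Option.elim_none, Option.elim_some, max_logHeight₁_two_one, one_mul]
  rw [hcard, hprod, hsum] at key
  exact key

/-- **Pasten's Theorem 1.4 (1) from any bound of Matveev's shape and Theorem 2.5.** If the
archimedean binder `hM` of `Dioph.thm328_rat_infinite_of_archBound` (Evertse–Győry's
Theorem 3.2.4 over `ℚ` with a generic constant `C(n)`, all `n ≥ 2`) holds for some `C` with
`log C(n) ≤ A n log(n + 1)` (`n ≥ 2`) — e.g. the printed
`C₁(n, 1) = min{(en/2) 30^{n+3} n^{3.5}, 2^{6n+20}}` [cite: EvertseGyory2015, Thm 3.2.4 (p. 61)],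
or any positive `C(n) ≤ 2^{6n+20}` (`A = 26`) — and `pasten2024_thm_2_5` holds, then
`pasten2024_thm_1_4_1` holds. No `p`-adic input and no cap on the constant are needed (contrast
`Dioph.evertseGyory_thm_4_2_1_rat_of_archBound_padicBound`, whose archimedean binder this is).
[cite: Pasten2024, Theorem 1.4 (1) and §4] -/
theorem pasten2024_thm_1_4_1_of_archBound (C : ℕ → ℝ) (A : ℝ)
    (hC : ∀ n : ℕ, 2 ≤ n → Real.log (C n) ≤ A * n * Real.log (n + 1))
    (hM : ∀ (κ : Type) [Fintype κ], 2 ≤ Fintype.card κ →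
      ∀ (a : κ → ℚ) (b : κ → ℤ) (A : κ → ℝ) (k₀ : κ) (B : ℝ),
        (∀ k, 0 < a k ∧ a k ≠ 1) → b ≠ 0 →
        ∑ k, (b k : ℝ) * Real.log (a k : ℝ) ≠ 0 →
        (∀ k, max (logHeight₁ (a k)) (max |Real.log (a k : ℝ)| 0.16) ≤ A k) →
        1 ≤ B → (∀ k, (|b k| : ℝ) * A k / A k₀ ≤ B) →
        -(C (Fintype.card κ) * (∏ k, A k) * Real.log (Real.exp 1 * B)) <
          Real.log |∑ k, (b k : ℝ) * Real.log (a k : ℝ)|)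
    (h25 : pasten2024_thm_2_5) : pasten2024_thm_1_4_1 := by
  refine pasten2024_thm_1_4_1_of_archProductBound (fun n => C (n + 1)) 1 (4 * max A 0) ?_
    (archProductBound_of_archBound C hM) h25
  -- growth of `n ↦ C(n+1)`: `log C(n+1) ≤ A (n+1) log(n+2) ≤ 4 max(A,0) n log(n+1)`
  intro n hn
  have hn1 : (1 : ℝ) ≤ n := by exact_mod_cast hn
  have hA0 : 0 ≤ max A 0 := le_max_right _ _
  have hlog1 : 0 ≤ Real.log ((n : ℝ) + 1) := Real.log_nonneg (by linarith)
  have hlog2 : 0 ≤ Real.log ((n : ℝ) + 2) := Real.log_nonneg (by linarith)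
  -- `log(n+2) ≤ 2 log(n+1)` as `n + 2 ≤ (n+1)²`
  have hll : Real.log ((n : ℝ) + 2) ≤ 2 * Real.log ((n : ℝ) + 1) := by
    have h2 : Real.log (((n : ℝ) + 1) ^ 2) = 2 * Real.log ((n : ℝ) + 1) := by
      rw [Real.log_pow]; push_cast; ring
    rw [← h2]
    exact Real.log_le_log (by linarith) (by nlinarith)
  have h := hC (n + 1) (by omega)
  push_cast at h
  calc Real.log (C (n + 1)) ≤ A * ((n : ℝ) + 1) * Real.log ((n : ℝ) + 1 + 1) := h
    _ = A * (((n : ℝ) + 1) * Real.log ((n : ℝ) + 2)) := by ring_nf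
    _ ≤ max A 0 * (((n : ℝ) + 1) * Real.log ((n : ℝ) + 2)) :=
        mul_le_mul_of_nonneg_right (le_max_left _ _) (by positivity)
    _ ≤ max A 0 * ((2 * n) * (2 * Real.log ((n : ℝ) + 1))) := by
        apply mul_le_mul_of_nonneg_left _ hA0
        exact mul_le_mul (by linarith) hll hlog2 (by positivity)
    _ = 4 * max A 0 * n * Real.log (n + 1) := by ring

/-- A capped constant `0 ≤ C(n) ≤ 2^{6n+20}` — the hypotheses `hC0`, `hCle` of
`Dioph.thm328_rat_infinite_of_archBound` — has growth `log C(n) ≤ 26 n log(n+1)` for `n ≥ 1`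
(`(6n+20) log 2 ≤ 26 n log(n+1)`; `log 0 = 0`). [folklore] -/
theorem log_le_growth_of_le_two_pow {C : ℕ → ℝ} {n : ℕ} (hn : 1 ≤ n) (hC0 : 0 ≤ C n)
    (hCle : C n ≤ 2 ^ (6 * n + 20)) : Real.log (C n) ≤ 26 * n * Real.log (n + 1) := by
  have hn1 : (1 : ℝ) ≤ n := by exact_mod_cast hn
  have hlog1 : 0 ≤ Real.log ((n : ℝ) + 1) := Real.log_nonneg (by linarith)
  rcases hC0.eq_or_lt with h | h
  · rw [← h, Real.log_zero]; positivity
  · have hlog2 : Real.log 2 ≤ Real.log ((n : ℝ) + 1) :=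
      Real.log_le_log (by norm_num) (by linarith)
    have hl2pos : 0 < Real.log 2 := Real.log_pos one_lt_two
    have hexp : ((6 * n + 20 : ℕ) : ℝ) ≤ 26 * n := by push_cast; linarith
    calc Real.log (C n) ≤ Real.log (2 ^ (6 * n + 20)) := Real.log_le_log h hCle
      _ = ((6 * n + 20 : ℕ) : ℝ) * Real.log 2 := by rw [Real.log_pow]
      _ ≤ (26 * n : ℝ) * Real.log ((n : ℝ) + 1) := mul_le_mul hexp hlog2 hl2pos.le (by positivity)
      _ = 26 * n * Real.log (n + 1) := by ring

/-- **Pasten's Theorem 1.4 (1) from the capped archimedean binder of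
`MultiplicativeGroupApproximationGenericInputsProofs.lean` and Theorem 2.5.** The three
hypotheses `hC0`, `hCle`, `hM` are verbatim those of `Dioph.thm328_rat_infinite_of_archBound`
(an archimedean lower bound of the shape of Evertse–Győry's Theorem 3.2.4 over `ℚ` with any
constant `0 ≤ C(n) ≤ 2^{6n+20}`, `n ≥ 2` [cite: EvertseGyory2015, Thm 3.2.4 (p. 61)]); so any
discharge of that binder — which, with Yu's `p`-adic bound, gives `evertseGyory_thm_4_2_1_rat`
there — gives `pasten2024_thm_1_4_1` here with Theorem 2.5 alone, no `p`-adic input.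
[cite: Pasten2024, Theorem 1.4 (1) and §4] -/
theorem pasten2024_thm_1_4_1_of_archBound_le_two_pow (C : ℕ → ℝ)
    (hC0 : ∀ n, 2 ≤ n → 0 ≤ C n) (hCle : ∀ n, 2 ≤ n → C n ≤ 2 ^ (6 * n + 20))
    (hM : ∀ (κ : Type) [Fintype κ], 2 ≤ Fintype.card κ →
      ∀ (a : κ → ℚ) (b : κ → ℤ) (A : κ → ℝ) (k₀ : κ) (B : ℝ),
        (∀ k, 0 < a k ∧ a k ≠ 1) → b ≠ 0 →
        ∑ k, (b k : ℝ) * Real.log (a k : ℝ) ≠ 0 →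
        (∀ k, max (logHeight₁ (a k)) (max |Real.log (a k : ℝ)| 0.16) ≤ A k) →
        1 ≤ B → (∀ k, (|b k| : ℝ) * A k / A k₀ ≤ B) →
        -(C (Fintype.card κ) * (∏ k, A k) * Real.log (Real.exp 1 * B)) <
          Real.log |∑ k, (b k : ℝ) * Real.log (a k : ℝ)|)
    (h25 : pasten2024_thm_2_5) : pasten2024_thm_1_4_1 :=
  pasten2024_thm_1_4_1_of_archBound C 26
    (fun n hn => log_le_growth_of_le_two_pow (by omega) (hC0 n hn) (hCle n hn)) hM h25

end Instances

end Literature.Barriers.ABC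

end
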